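import Summits.CriticalPhenomena.CardyFormulaZ2.Theses.CardyComplexCone
import Summits.CriticalPhenomena.CardyFormulaZ2.Theorems.CardyComplexConeDefs
import Literature.Barriers.CriticalPhenomena.FKParafermionicHalfCauchyRiemann
import Literature.Probability.RandomPlanarGeometry.SLEUniquenessInLaw
import HarnessLib

/-!
# Vocabulary of line `iic-trace-flux-pairing` for crux `ParafermionToSLESixFamilies` (stmt-CriticalPhenomena-11389)

Route `CardyComplexCone` (sub-problem `CriticalPhenomena/CardyFormulaZ2`), crux
`Summit.CriticalPhenomena.CardyFormulaZ2.Theses.CardyComplexCone.ParafermionToSLESixFamilies` (literally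
`WeakHolFamilies → PrecompactFamilies → SLESixAllFamilies`, the three blocks below). This file is the
**definitions module** of the checked skeleton `Cruxes/ParafermionToSLESixFamilies/Lines/iic_trace_flux_pairing.lean`
(planner `planner-cruxplan-stmt-CriticalPhenomena-11389-iic-trace-flux-pairi-0`, lead
`prover-line-stmt-CriticalPhenomena-11389-0` — second pick after line `caratheodory-net-slit-uniformity` died,
`Lines/caratheodory-net-slit-uniformity-dead.md`): it carries, verbatim and sorry-free, the skeleton's VOCABULARY —
the three crux blocks, the family bundling `IsFamily` / `iface` / `perc` / `SLESixAlong`, the corner-class field `G` and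
its staggered combination `stagger` (`StaggeredVanishingFamilies`), the half-plane one-arm statement
`HalfPlaneOneArmLower`, the strip rigidity statement `StripRigidityWeak`, the touch vocabulary (`touchSites`,
`touchProb`, `touchFunctional`, `IsAxisDir`, `nCoord`, `tCoord`, `IsFlatFreeWindow`, `HasTouchDensityAt`,
`TouchLawPos`), `IsRectilinear`, `TightOnRectilinear`, `IdentOnRectilinear` — so that the stub helper files
`Theorems/CardyComplexConeParafermionToSLESixFamiliesIic<Stub>.lean` (each proving `theorem stub_<x> : <signature>`
by name, `--supports stmt-CriticalPhenomena-11389`) and the closing skeleton share ONE copy of every object. NOTHING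
here is asserted: every `def … : Prop` is a stub statement or a hypothesis of one (three of them — `UniformInnerEnvelope`
of `CardyComplexConeDefs`, `HalfPlaneOneArmLower`, `StaggeredVanishingFamilies` — are acknowledged open percolation
inputs of conjecture strength); the one theorem is the registered unbundling glue `slesixAllFamilies_iff`.

Sources: H. Duminil-Copin, arXiv:1208.3787, Prop. 4–5 (parafermion at q = 1, touch ⇔ boundary passage);
H. Duminil-Copin, S. Smirnov, arXiv:1109.1549, §8.3; S. Smirnov, W. Werner, Math. Res. Lett. 8 (2001) (β₁⁺ = 1/3 on 𝕋);
F. Camia, C. Newman, PTRF 139 (2007), §§5–7; A. Kemppainen, S. Smirnov, Ann. Probab. 45 (2017).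
-/

noncomputable section

namespace Summit.CriticalPhenomena.CardyFormulaZ2.Cruxes.ParafermionToSLESixFamilies.IicTraceFluxPairing

open scoped Topology NNReal ENNReal BigOperators
open Filter MeasureTheory Set Metric
open UpperHalfPlane (upperHalfPlaneSet)
open Literature.Probability.LatticeModels Literature.Probability.Percolation
open Literature.Probability.RandomPlanarGeometry
open Literature.Barriers.CriticalPhenomena (medialCornersAt medialVertexOf)
open Summit.CriticalPhenomena.CardyFormulaZ2.Theses.CardyComplexCone (ParafermionToSLESixFamilies)
open Summit.CriticalPhenomena.CardyFormulaZ2.Cruxes.EdgePrecompact.QkzStripBoundaryArm (cornerObs UniformInnerEnvelope)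


/-! ## §0 The three blocks of the crux, verbatim (as in Disproof.lean §0) -/

/-- Hypothesis A of the crux (weak holomorphy, family form), verbatim. -/
def WeakHolFamilies : Prop :=
  ∀ (D : Literature.Probability.RandomPlanarGeometry.DobrushinDomain) (Λ : ℝ → Literature.Probability.LatticeModels.DiscreteDobrushin), (∀ δ, (Λ δ).Ω = D.carrier) → (∀ δ, (Λ δ).δ = δ) → (∀ᶠ δ in 𝓝[>] (0:ℝ), (Λ δ).IsZdAdmissible) → ∀ (φ : ℂ → ℂ), ContDiff ℝ (⊤ : ℕ∞) φ → HasCompactSupport φ → tsupport φ ⊆ D.carrier → Tendsto (fun δ : ℝ => ((δ ^ ((5:ℝ) / 3) : ℝ) : ℂ) * ∑ᶠ z : Literature.Probability.LatticeModels.MedialVertex, (∫ ω, Literature.Probability.LatticeModels.MedialPath.passageSum (Literature.Probability.LatticeModels.medialExploration (Λ δ) ω) δ (1 / 3) z ∂(Literature.Probability.Percolation.bondPercolation (Literature.Probability.LatticeModels.zdGraph 2) Literature.Probability.Percolation.half)) * ((fderiv ℝ φ (Literature.Probability.LatticeModels.medialPoint δ z) 1 + Complex.I * fderiv ℝ φ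 (Literature.Probability.LatticeModels.medialPoint δ z) Complex.I) / 2)) (𝓝[>] (0:ℝ)) (𝓝 0)

/-- Hypothesis B of the crux (local boundedness + equicontinuity of `δ^{-1/3}F_δ` on lattice edges), verbatim. -/
def PrecompactFamilies : Prop :=
  ∀ (D : Literature.Probability.RandomPlanarGeometry.DobrushinDomain) (Λ : ℝ → Literature.Probability.LatticeModels.DiscreteDobrushin), (∀ δ, (Λ δ).Ω = D.carrier) → (∀ δ, (Λ δ).δ = δ) → (∀ᶠ δ in 𝓝[>] (0:ℝ), (Λ δ).IsZdAdmissible) → let F : ℝ → Literature.Probability.LatticeModels.MedialVertex → ℂ := fun δ z => ∫ ω, Literature.Probability.LatticeModels.MedialPath.passageSum (Literature.Probability.LatticeModels.medialExploration (Λ δ) ω) δ (1 / 3) z ∂(Literature.Probability.Percolation.bondPercolation (Literature.Probability.LatticeModels.zdGraph 2) Literature.Probability.Percolation.half); ∀ K : Set ℂ, IsCompact K → K ⊆ D.carrier → (∃ C : ℝ, ∀ᶠ δ in 𝓝[>] (0:ℝ), ∀ z : Literature.Probability.LatticeModels.MedialVertex, z ∈ (Literature.Probability.LatticeModels.zdGraph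 2).edgeSet → Literature.Probability.LatticeModels.medialPoint δ z ∈ K → ‖F δ z‖ ≤ C * δ ^ ((1:ℝ) / 3)) ∧ (∀ ε > (0:ℝ), ∃ η > (0:ℝ), ∀ᶠ δ in 𝓝[>] (0:ℝ), ∀ z z' : Literature.Probability.LatticeModels.MedialVertex, z ∈ (Literature.Probability.LatticeModels.zdGraph 2).edgeSet → z' ∈ (Literature.Probability.LatticeModels.zdGraph 2).edgeSet → Literature.Probability.LatticeModels.medialPoint δ z ∈ K → Literature.Probability.LatticeModels.medialPoint δ z' ∈ K → dist (Literature.Probability.LatticeModels.medialPoint δ z) (Literature.Probability.LatticeModels.medialPoint δ z') < η → ‖F δ z - F δ z'‖ ≤ ε * δ ^ ((1:ℝ) / 3))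

/-- Conclusion C of the crux (SLE₆ for every Dobrushin domain and every discretisation family), verbatim. -/
def SLESixAllFamilies : Prop :=
  ∀ (D : Literature.Probability.RandomPlanarGeometry.DobrushinDomain) (Λ : ℝ → Literature.Probability.LatticeModels.DiscreteDobrushin), (∀ δ, (Λ δ).Ω = D.carrier) → (∀ δ, (Λ δ).δ = δ) → Tendsto (fun δ : ℝ => Metric.hausdorffEDist (Λ δ).arcA (D.arc 0)) (𝓝[>] (0:ℝ)) (𝓝 0) → Tendsto (fun δ : ℝ => Metric.hausdorffEDist (Λ δ).arcB (D.arc 1)) (𝓝[>] (0:ℝ)) (𝓝 0) → Tendsto (fun δ : ℝ => Metric.hausdorffEDist (Literature.Probability.LatticeModels.medialPoint δ '' (Λ δ).zdABEdges) {D.pt 0, D.pt 1}) (𝓝[>] (0:ℝ)) (𝓝 0) → (∀ᶠ δ in 𝓝[>] (0:ℝ), (Λ δ).IsZdAdmissible) → Literature.Probability.RandomPlanarGeometry.ConvergesInLawToSLE 6 D (Ωδ := fun _ => Literature.Probability.Percolation.BondConfig (Literature.Probability.LatticeModels.Site 2)) (fun δ ω => Literature.Probability.RandomPlanarGeometry.CurveClass.mk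 (if dist (Literature.Probability.LatticeModels.medialExplorationCurve (Λ δ) ω 0) (D.pt 0) ≤ dist (Literature.Probability.LatticeModels.medialExplorationCurve (Λ δ) ω 0) (D.pt 1) then (⟨Literature.Probability.LatticeModels.medialExplorationCurve (Λ δ) ω⟩ : Literature.Probability.RandomPlanarGeometry.Curve ℂ) else ⟨(Literature.Probability.LatticeModels.medialExplorationCurve (Λ δ) ω).comp ⟨unitInterval.symm, unitInterval.continuous_symm⟩⟩)) (fun _ => Literature.Probability.Percolation.bondPercolation (Literature.Probability.LatticeModels.zdGraph 2) Literature.Probability.Percolation.half)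

/-- The six family fields of C, bundled: `(Λ δ).Ω = D`, mesh `δ`, arcs → `(ab)`, `(ba)`, discrete marks → `{a, b}`,
eventually `ℤ²`-admissible. -/
def IsFamily (D : DobrushinDomain) (Λ : ℝ → DiscreteDobrushin) : Prop :=
  (∀ δ, (Λ δ).Ω = D.carrier) ∧ (∀ δ, (Λ δ).δ = δ) ∧
  Tendsto (fun δ : ℝ => Metric.hausdorffEDist (Λ δ).arcA (D.arc 0)) (𝓝[>] (0:ℝ)) (𝓝 0) ∧
  Tendsto (fun δ : ℝ => Metric.hausdorffEDist (Λ δ).arcB (D.arc 1)) (𝓝[>] (0:ℝ)) (𝓝 0) ∧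
  Tendsto (fun δ : ℝ => Metric.hausdorffEDist (medialPoint δ '' (Λ δ).zdABEdges) {D.pt 0, D.pt 1})
    (𝓝[>] (0:ℝ)) (𝓝 0) ∧
  (∀ᶠ δ in 𝓝[>] (0:ℝ), (Λ δ).IsZdAdmissible)

/-- The interface functional of C (verbatim): the medial exploration curve of `Λ δ`, oriented `a → b`, modulo
reparametrisation. -/
abbrev iface (D : DobrushinDomain) (Λ : ℝ → DiscreteDobrushin) : ∀ _δ : ℝ, BondConfig (Site 2) → CurveClass ℂ :=
  fun δ ω => CurveClass.mk
    (if dist (medialExplorationCurve (Λ δ) ω 0) (D.pt 0) ≤ dist (medialExplorationCurve (Λ δ) ω 0) (D.pt 1)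
      then (⟨medialExplorationCurve (Λ δ) ω⟩ : Curve ℂ)
      else ⟨(medialExplorationCurve (Λ δ) ω).comp ⟨unitInterval.symm, unitInterval.continuous_symm⟩⟩)

/-- The laws of C (verbatim): critical bond percolation on `ℤ²` at every mesh. -/
abbrev perc : ∀ _δ : ℝ, Measure (BondConfig (Site 2)) := fun _ => bondPercolation (zdGraph 2) half

/-- SLE₆ convergence of the interface of `D` along `Λ` (the conclusion of C for one pair `(D, Λ)`, verbatim). -/
abbrev SLESixAlong (D : DobrushinDomain) (Λ : ℝ → DiscreteDobrushin) : Prop :=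
  ConvergesInLawToSLE 6 D (Ωδ := fun _ => BondConfig (Site 2)) (iface D Λ) perc

/-- Unbundling: C is `∀ D Λ, IsFamily D Λ → SLESixAlong D Λ`. -/
theorem slesixAllFamilies_iff :
    SLESixAllFamilies ↔ ∀ (D : DobrushinDomain) (Λ : ℝ → DiscreteDobrushin), IsFamily D Λ → SLESixAlong D Λ :=
  ⟨fun h D Λ hΛ => h D Λ hΛ.1 hΛ.2.1 hΛ.2.2.1 hΛ.2.2.2.1 hΛ.2.2.2.2.1 hΛ.2.2.2.2.2,
    fun h D Λ h1 h2 h3 h4 h5 h6 => h D Λ ⟨h1, h2, h3, h4, h5, h6⟩⟩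

/-! ## §1 Vocabulary of the line -/

/-- The spin-`1/3` corner observable at the `k`-th corner (`NW, NE, SE, SW` clockwise, the barrier file's certified table
`medialCornersAt`) of the medial vertex `s(x, x + eᵢ)`, `p = (x, i)`; `cornerObs` of `Theorems/CardyComplexConeDefs.lean`
(verbatim the integrand of the route's `EdgeCoherence` / `EdgePrecompact`). -/
def G (E : DiscreteDobrushin) (δ : ℝ) (p : Site 2 × Fin 2) (k : Fin 4) : ℂ :=
  cornerObs E δ (medialCornersAt p.1 p.2 k).1 (medialCornersAt p.1 p.2 k).2

/-- The STAGGERED combination `G(NW) − G(NE) + G(SE) − G(SW)` = (darts along one lattice diagonal) − (darts along the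
other): the lattice carrier of the antiholomorphic mode `s` of triage finding S0. -/
def stagger (E : DiscreteDobrushin) (δ : ℝ) (p : Site 2 × Fin 2) : ℂ :=
  G E δ p 0 - G E δ p 1 + G E δ p 2 - G E δ p 3

/-- STAGGERED VANISHING along every family with the crux's guards (`Ω = D`, mesh `δ`, eventually admissible): on every
compact `K ⊂ D`, `‖stagger‖ ≤ ε δ^{1/3}` eventually at every medial vertex over `K`. -/
def StaggeredVanishingFamilies : Prop :=
  ∀ (D : DobrushinDomain) (Λ : ℝ → DiscreteDobrushin), (∀ δ, (Λ δ).Ω = D.carrier) → (∀ δ, (Λ δ).δ = δ) →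
    (∀ᶠ δ in 𝓝[>] (0:ℝ), (Λ δ).IsZdAdmissible) →
    ∀ K : Set ℂ, IsCompact K → K ⊆ D.carrier → ∀ ε > (0:ℝ), ∀ᶠ δ in 𝓝[>] (0:ℝ),
      ∀ p : Site 2 × Fin 2, medialPoint δ (medialVertexOf p) ∈ K → ‖stagger (Λ δ) δ p‖ ≤ ε * δ ^ ((1:ℝ) / 3)

/-- HALF-PLANE ONE-ARM LOWER BOUND (K2, lower half only): `π₁⁺(n) ≥ c n^{-1/3}` eventually, for the event "the origin is
joined inside the box `[−n, n] × [0, n]` of the upper half-plane to its outer boundary" under `P_{1/2}` on bond-`ℤ²`.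
(Verbatim the `HalfPlaneOneArmLower` of crux 10814's free-arc line.) Open; only `0 < β₁⁺ ≤ 1/2` is rigorous on `ℤ²`. -/
def HalfPlaneOneArmLower : Prop :=
  ∃ c : ℝ, 0 < c ∧ ∀ᶠ n : ℕ in atTop,
    c * (n : ℝ) ^ (-((1:ℝ) / 3)) ≤ (bondPercolation (zdGraph 2) half).real
      {ω | ∃ y : Site 2, (y 0 = (n : ℤ) ∨ y 0 = -(n : ℤ) ∨ y 1 = (n : ℤ)) ∧
        ω ∈ openConnIn {v : Site 2 | 0 ≤ v 1 ∧ -(n : ℤ) ≤ v 0 ∧ v 0 ≤ n ∧ v 1 ≤ n} 0 y}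

/-- STRIP RIGIDITY, weak-boundary-value form (the card's First lemma as sharpened by triage r1-1/r1-2). `u` holomorphic on
the open strip `S = {0 < Im w < 1}`; growth `‖u w‖ ≤ C (Im w)^{-p} (1 − Im w)^{-p} e^{a |Re w|}` with `p < 1`, `a < 2π`;
weak boundary values on BOTH lines non-negative: for every smooth compactly supported `φ ≥ 0` on `ℝ` whose support avoids
a finite exceptional set (`B₀` on the bottom line, `B₁` on the top line), `∫ u(x + iy) φ(x) dx` tends, as `y → 0⁺`
(resp. `y → 1⁻`), to a non-negative real. Then `u` is a non-negative constant on `S`. -/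
def StripRigidityWeak : Prop :=
  ∀ (u : ℂ → ℂ) (C a p : ℝ) (B₀ B₁ : Finset ℝ), a < 2 * Real.pi → p < 1 →
    DifferentiableOn ℂ u {w : ℂ | 0 < w.im ∧ w.im < 1} →
    (∀ w : ℂ, 0 < w.im → w.im < 1 →
      ‖u w‖ ≤ C * w.im ^ (-p) * (1 - w.im) ^ (-p) * Real.exp (a * |w.re|)) →
    (∀ φ : ℝ → ℝ, ContDiff ℝ (⊤ : ℕ∞) φ → HasCompactSupport φ → (∀ x, 0 ≤ φ x) →
      Disjoint (tsupport φ) (↑B₀ : Set ℝ) →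
      ∃ L : ℝ, 0 ≤ L ∧ Tendsto (fun y : ℝ => ∫ x : ℝ, u ((x : ℂ) + (y : ℂ) * Complex.I) * (φ x : ℂ))
        (𝓝[>] (0:ℝ)) (𝓝 (L : ℂ))) →
    (∀ φ : ℝ → ℝ, ContDiff ℝ (⊤ : ℕ∞) φ → HasCompactSupport φ → (∀ x, 0 ≤ φ x) →
      Disjoint (tsupport φ) (↑B₁ : Set ℝ) →
      ∃ L : ℝ, 0 ≤ L ∧ Tendsto (fun y : ℝ => ∫ x : ℝ, u ((x : ℂ) + (y : ℂ) * Complex.I) * (φ x : ℂ))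
        (𝓝[<] (1:ℝ)) (𝓝 (L : ℂ))) →
    ∃ c : ℝ, 0 ≤ c ∧ ∀ w : ℂ, 0 < w.im → w.im < 1 → u w = c

/-! ### Touch vocabulary (phase-free face of the parafermion on the free arc; shapes as in crux 10814's free-arc line) -/

/-- Touch sites of `E`: sites off both discrete arcs that are a corner of an INNER face having a corner on the dual-wired
arc `B` (adjacency to `B` read through inner faces). In the H21 rendering (`bcBondConfig` closes every edge at a `B` site)
the interface touches the free arc exactly at these sites, and does so at `x` iff `x ↔ A` (Duminil-Copin 2012 Prop. 5). -/
def touchSites (E : DiscreteDobrushin) : Set (Site 2) :=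
  {x | x ∉ E.zdArcA ∧ x ∉ E.zdArcB ∧
    ∃ f : Site 2, E.IsInnerFace f ∧ IsCorner x f ∧ ∃ u : Site 2, IsCorner u f ∧ u ∈ E.zdArcB}

/-- Touch probability `P_{1/2}(x ↔ A)` in the boundary-condition-completed configuration (a monotone event). -/
def touchProb (E : DiscreteDobrushin) (x : Site 2) : ℝ :=
  (bondPercolation (zdGraph 2) half).real
    {ω | ∃ y ∈ E.zdArcA, (openGraph (E.bcBondConfig ω)).Reachable x y}

/-- The renormalised touch intensity tested against `g`: `ν_E(g) = δ^{2/3} Σ_{x touch site} P(x ↔ A) g(δx)` — the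
normalisation the flux pairing produces (boundary flux `O(δ^{-2/3})` = interior pairing `δ · δ^{-2} · δ^{1/3}`). -/
def touchFunctional (E : DiscreteDobrushin) (g : ℂ → ℝ) : ℝ :=
  E.δ ^ ((2:ℝ) / 3) *
    ∑ᶠ x : Site 2, (touchSites E).indicator (fun x => touchProb E x * g (meshPoint E.δ x)) x

/-- Axis directions (inward unit normals of axis-parallel sides). -/
def IsAxisDir (η : ℂ) : Prop := η = 1 ∨ η = -1 ∨ η = Complex.I ∨ η = -Complex.I

/-- Normal coordinate of `z` in the frame `(m, η)`. -/
def nCoord (m η z : ℂ) : ℝ := ((z - m) * (starRingEnd ℂ) η).re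

/-- Tangential coordinate of `z` in the frame `(m, η)`. -/
def tCoord (m η z : ℂ) : ℝ := ((z - m) * (starRingEnd ℂ) (Complex.I * η)).re

/-- A FLAT FREE WINDOW of `D`: the open box `{|tCoord| < a, |nCoord| < b}` at the boundary point `m` with inward axis
normal `η` meets `D` exactly in its inner half, its mid-segment lies on the free arc `(ba) = D.arc 1`, and it avoids the
two marked points. -/
structure IsFlatFreeWindow (D : DobrushinDomain) (m η : ℂ) (a b : ℝ) : Prop where
  axis : IsAxisDir η
  a_pos : 0 < a
  b_pos : 0 < b
  carrier_iff : ∀ z : ℂ, |tCoord m η z| < a → |nCoord m η z| < b → (z ∈ D.carrier ↔ 0 < nCoord m η z)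
  subset_arc : ∀ z : ℂ, |tCoord m η z| < a → nCoord m η z = 0 → z ∈ D.arc 1
  marks : ∀ z : ℂ, |tCoord m η z| < a → |nCoord m η z| < b → z ≠ D.pt 0 ∧ z ≠ D.pt 1

/-- The covariant weight-`1/3` touch density at a free-arc point `y`: `ρ = lim_{z → y, z ∈ D} |ψ′(z)/ψ(z)|^{1/3}` for
`ψ = φ⁻¹ : D → ℍ` the inverse of ANY chordal uniformizing map (`ψ′/ψ = (log ψ)′` is dilation invariant, i.e. `π` times
the derivative of the strip map; `ρ = π^{1/3} |Φ′_{strip}|^{1/3}` — the modulus of this line's `(Φ′)^{1/3}`). -/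
def HasTouchDensityAt (D : DobrushinDomain) (y : ℂ) (ρ : ℝ) : Prop :=
  ∀ φ : ConformalEquiv upperHalfPlaneSet D.carrier, D.IsChordalUniformizing φ →
    Tendsto (fun z : ℂ => ‖deriv (fun w : ℂ => φ.symm w) z / φ.symm z‖ ^ ((1:ℝ) / 3))
      (𝓝[D.carrier] y) (𝓝 ρ)

/-- TOUCH INTENSITY LAW with positive amplitude for `D` (the output of the engine S5, the input of the tail S6): along
every admissible family `Λ` of `D` and on every flat free window, the covariant density `ρ` exists on the window and, along
every mesh sequence `u_k → 0⁺`, a subsequence of the renormalised touch intensities converges vaguely on the window to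
`c · ρ · (length)` for some `c > 0` (which may depend on family, window and subsequence — positivity is all S6 uses). -/
def TouchLawPos (D : DobrushinDomain) : Prop :=
  ∀ Λ : ℝ → DiscreteDobrushin, IsFamily D Λ →
    ∀ (m η : ℂ) (a b : ℝ), IsFlatFreeWindow D m η a b →
      ∃ ρ : ℂ → ℝ, (∀ y : ℂ, |tCoord m η y| < a → nCoord m η y = 0 → HasTouchDensityAt D y (ρ y)) ∧
        ∀ u : ℕ → ℝ, Tendsto u atTop (𝓝[>] (0:ℝ)) →
          ∃ (s : ℕ → ℕ) (c : ℝ), StrictMono s ∧ 0 < c ∧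
            ∀ g : ℂ → ℝ, Continuous g → HasCompactSupport g →
              tsupport g ⊆ {z | |tCoord m η z| < a ∧ |nCoord m η z| < b} →
              Tendsto (fun k : ℕ => touchFunctional (Λ (u (s k))) g) atTop
                (𝓝 (c * ∫ t in Set.Ioo (-a) a,
                  g (m + (t : ℂ) * (Complex.I * η)) * ρ (m + (t : ℂ) * (Complex.I * η))))

/-- RECTILINEAR Dobrushin polygons: the Jordan boundary is a finite union of axis-parallel segments (marks anywhere on it) —
the class on which the boundary phase of the parafermion is lattice-determined side by side (ℤ²'s quarter-turn symmetry
relates horizontal and vertical sides; for slanted sides the boundary-layer renormalisation is unknown). -/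
def IsRectilinear (D : DobrushinDomain) : Prop :=
  ∃ S : Finset (ℂ × ℂ), (∀ e ∈ S, (e.1 - e.2).re = 0 ∨ (e.1 - e.2).im = 0) ∧
    frontier D.carrier = ⋃ e ∈ S, segment ℝ e.1 e.2

/-- Tightness of the interface functional along every admissible family of every rectilinear polygon. -/
def TightOnRectilinear : Prop :=
  ∀ D : DobrushinDomain, IsRectilinear D → ∀ Λ : ℝ → DiscreteDobrushin, IsFamily D Λ →
    IsTightAlongMesh (iface D Λ) perc

/-- Identification of every subsequential limit law of the interface as the chordal SLE₆ law, on rectilinear polygons. -/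
def IdentOnRectilinear : Prop :=
  ∀ D : DobrushinDomain, IsRectilinear D → ∀ Λ : ℝ → DiscreteDobrushin, IsFamily D Λ →
    ∀ μ : Measure (CurveClass ℂ), IsProbabilityMeasure μ → IsSubseqLimitLaw (iface D Λ) perc μ → IsSLELaw 6 D μ


end Summit.CriticalPhenomena.CardyFormulaZ2.Cruxes.ParafermionToSLESixFamilies.IicTraceFluxPairing

end
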